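/-
Copyright (c) 2026. All rights reserved.
Released under Apache 2.0 license as described in the file LICENSE.
-/
import Summits.ValiantsHypothesis.ValiantsHypothesis.Theorems.ReadOnceColSparseSupport
import HarnessLib

/-!
# Read-once determinantal templates: every coefficient is ONE complementary minor

For a template `E : Matrix (Fin r) (Fin r) (M ⊕ F)` with READ-ONCE variables and constants
ARBITRARY in value and position (the templates of item 20152), `D_E = det (E.map (Sum.elim X C))`
is multilinear in the variables; its monomials are the monomials `monoOfO (optLab E) σ` of the
variable cells met by a permutation `σ`, whose FREE COLUMNS `freeCols E σ` are those where it
meets a constant; `constMat E` is the constant matrix (`0` on variable cells).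
* §2 `monoOfO_eq_iff`: read-once ALONE fixes the fibres of `σ ↦ monoOfO σ` (`τ` has the
  monomial of `σ` iff `τ = σ` on the matched columns and `τ` is free where `σ` is free).
* §3 `coeff_monoOfO_eq_det_exchMat`: so the coefficient of the monomial of `σ` is ONE
  determinant, of the EXCHANGE MATRIX `exchMat E σ` = the constant matrix with every matched
  column `k` replaced by the unit vector of the matched row `σ k` — no signed sum is left;
* §4 `det_exchMat_eq_sign_mul_det_coMinor`: `= sign σ · det (coMinor E σ)`, the COMPLEMENTARY
  MINOR of the constant matrix (free columns × rows unused by the variable cells) — the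
  Cauchy–Binet / generalised Laplace expansion of a rank-one pencil `Σ_e x_e a_e b_eᵀ` of
  mixed-matrix theory [cite: FurueHirai2019, Lemma 3.1];
* §5 the support of `D_E` is the MATCHING–MINOR FAMILY `{monoOfO σ | det (exchMat E σ) ≠ 0}`
  (`mem_support_iff_exists_exchMat`, `det_ne_zero_iff_exists_exchMat`), and a weight isolates a
  minimum monomial of `D_E` iff it isolates a minimum-weight NON-SINGULAR EXCHANGE
  (`isolatesMin_iff_exchMat`) — the common bases of the partition matroid «one cell per column»
  and the linear matroid of the columns `{e_j} ∪ {A_k}`: the TARGET of rung 2 of the W4 ladder is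
  a small-circuit weight isolating a common base of a LINEAR MATROID INTERSECTION
  [cite: GurjarThierauf2017, Abstract] — typed here, not attempted.
Unique completion (`monoOfO_mem_support`, `monoOfO_mem_support_forest`) is the case «`coMinor E σ`
triangular with non-zero diagonal up to order»; the tightness witness `E₃` of
`ReadOnceForestTight` is the first genuine `2 × 2` minor, `det [[1,1],[1,1]] = 0`.
Currency: kernel-certified W4 helper (O-L2-22: TYPES the target of rung 2, contains no
isolation); closes no item; data defs `constMat`, `freeCols`, `exchMat`, `coMinor`; no facts/doors;
`0` `S`-currency; mathematics KNOWN (mixed matrices), new in the tree.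
[cite: FennerGurjarThierauf2016, Section 3], [cite: ForbesShpilkaVolk2018, §8].
-/

set_option linter.dupNamespace false

namespace Summit.ValiantsHypothesis.ValiantsHypothesis.Theorems.ReadOnceComplementaryMinor

open MvPolynomial Summit.ValiantsHypothesis.ValiantsHypothesis.Theorems.ReadOnceColSparseSupport

noncomputable section

variable {F : Type*} [Field F] {M : Type*} {r : ℕ}

/-! ### §1 Constant matrix, free columns, exchange matrix, complementary minor -/

/-- The CONSTANT MATRIX `A` of a template: its constants, `0` on variable cells. [folklore] -/
def constMat (E : Matrix (Fin r) (Fin r) (M ⊕ F)) : Matrix (Fin r) (Fin r) F :=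
  fun j k => Sum.elim (fun _ => (0 : F)) id (E j k)

/-- The FREE COLUMNS of a permutation: the columns where it meets a constant. [this file] -/
def freeCols (E : Matrix (Fin r) (Fin r) (M ⊕ F)) (σ : Equiv.Perm (Fin r)) : Finset (Fin r) :=
  Finset.univ.filter fun k => optLab E k (σ k) = none

/-- The EXCHANGE MATRIX of `σ`: the constant matrix with every matched column `k ∉ freeCols E σ`
(where `σ` meets a variable cell) replaced by the unit vector of the matched row. [this file] -/
def exchMat (E : Matrix (Fin r) (Fin r) (M ⊕ F)) (σ : Equiv.Perm (Fin r)) :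
    Matrix (Fin r) (Fin r) F :=
  fun j k => if k ∈ freeCols E σ then constMat E j k else if j = σ k then 1 else 0

/-- The COMPLEMENTARY MINOR of `σ`: the constant matrix on the rows `σ '' L̄` and the free
columns `L̄ = freeCols E σ` (both indexed by `L̄`, the rows through `σ`). [this file] -/
def coMinor (E : Matrix (Fin r) (Fin r) (M ⊕ F)) (σ : Equiv.Perm (Fin r)) :
    Matrix (freeCols E σ) (freeCols E σ) F :=
  fun i k => constMat E (σ i.1) k.1

omit [Field F] in
/-- Membership in the free columns. [this file] -/
theorem mem_freeCols (E : Matrix (Fin r) (Fin r) (M ⊕ F)) {σ : Equiv.Perm (Fin r)}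
    {k : Fin r} : k ∈ freeCols E σ ↔ optLab E k (σ k) = none := by simp [freeCols]

omit [Field F] in
/-- A matched (non-free) column holds a variable cell of `σ`. [this file] -/
theorem exists_eq_some_of_not_mem_freeCols (E : Matrix (Fin r) (Fin r) (M ⊕ F))
    {σ : Equiv.Perm (Fin r)} {k : Fin r} (hk : k ∉ freeCols E σ) :
    ∃ μ, optLab E k (σ k) = some μ :=
  Option.ne_none_iff_exists'.1 fun h => hk ((mem_freeCols E).2 h)

/-- On a free position the Leibniz factor is the entry of the constant matrix. [this file] -/
theorem elim_one_eq_constMat (E : Matrix (Fin r) (Fin r) (M ⊕ F)) {j k : Fin r}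
    (h : optLab E k j = none) : Sum.elim (fun _ => (1 : F)) id (E j k) = constMat E j k := by
  obtain ⟨c, hc⟩ := (optLab_eq_none_iff E).1 h; simp [constMat, hc]

/-- On a variable cell the Leibniz factor is `1` and the constant matrix is `0`. [this file] -/
theorem elim_one_eq_one (E : Matrix (Fin r) (Fin r) (M ⊕ F)) {j k : Fin r} {μ : M}
    (h : optLab E k j = some μ) :
    Sum.elim (fun _ => (1 : F)) id (E j k) = 1 ∧ constMat E j k = 0 := by
  simp [constMat, (optLab_eq_some_iff E).1 h]

/-! ### §2 Read-once: which permutations share a monomial -/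

omit [Field F] in
/-- READ-ONCE ALONE determines the fibres of `σ ↦ monoOfO σ`: `τ` has the monomial of `σ`
iff `τ = σ` on the matched columns of `σ` and `τ` meets constants on its free columns.
[this file] -/
theorem monoOfO_eq_iff (E : Matrix (Fin r) (Fin r) (M ⊕ F))
    (hro : ∀ p q : Fin r × Fin r, ∀ m, E p.1 p.2 = .inl m → E q.1 q.2 = .inl m → p = q)
    {σ τ : Equiv.Perm (Fin r)} :
    monoOfO (optLab E) τ = monoOfO (optLab E) σ ↔
      (∀ k, k ∉ freeCols E σ → τ k = σ k) ∧
        ∀ k, k ∈ freeCols E σ → k ∈ freeCols E τ := by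
  have key : ∀ {σ τ : Equiv.Perm (Fin r)}, monoOfO (optLab E) τ = monoOfO (optLab E) σ →
      ∀ k μ, optLab E k (σ k) = some μ → τ k = σ k := by
    intro σ τ h k μ hk
    have hne : monoOfO (optLab E) τ μ ≠ 0 := by
      rw [h]
      exact monoOfO_apply_ne_zero.2 ⟨k, hk⟩
    obtain ⟨k', hk'⟩ := monoOfO_apply_ne_zero.1 hne
    have hpq := hro (σ k, k) (τ k', k') μ ((optLab_eq_some_iff E).1 hk)
      ((optLab_eq_some_iff E).1 hk')
    simp only [Prod.mk.injEq] at hpq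
    obtain ⟨hst, rfl⟩ := hpq
    exact hst.symm
  constructor
  · intro h
    refine ⟨fun k hk => ?_, fun k hk => ?_⟩
    · obtain ⟨μ, hμ⟩ := exists_eq_some_of_not_mem_freeCols E hk
      exact key h k μ hμ
    · rw [mem_freeCols] at hk ⊢
      cases hτk : optLab E k (τ k) with
      | none => rfl
      | some ν => rw [← key h.symm k ν hτk, hk] at hτk; exact absurd hτk (by simp)
  · rintro ⟨hag, hfr⟩
    unfold monoOfO
    refine Finset.sum_congr rfl fun k _ => ?_
    by_cases hk : k ∈ freeCols E σ
    · rw [(mem_freeCols E).1 hk, (mem_freeCols E).1 (hfr k hk)]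
    · rw [hag k hk]

/-- Leibniz-term bookkeeping: the term of `τ` counts for the monomial of `σ` iff `τ = σ` on the
matched columns, and then its constant factor is the product of the constant matrix over the free
columns (`0` by itself when `τ` runs through a variable cell there). [this file] -/
theorem ite_prodConst_eq (E : Matrix (Fin r) (Fin r) (M ⊕ F))
    (hro : ∀ p q : Fin r × Fin r, ∀ m, E p.1 p.2 = .inl m → E q.1 q.2 = .inl m → p = q)
    (σ τ : Equiv.Perm (Fin r)) [Decidable (monoOfO (optLab E) τ = monoOfO (optLab E) σ)] :
    (if monoOfO (optLab E) τ = monoOfO (optLab E) σ then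
        ∏ k, Sum.elim (fun _ => (1 : F)) id (E (τ k) k) else 0) =
      if (∀ k, k ∉ freeCols E σ → τ k = σ k) then
        ∏ k ∈ freeCols E σ, constMat E (τ k) k else 0 := by
  by_cases hag : ∀ k, k ∉ freeCols E σ → τ k = σ k
  · rw [if_pos hag]
    by_cases hfr : ∀ k, k ∈ freeCols E σ → k ∈ freeCols E τ
    · rw [if_pos ((monoOfO_eq_iff E hro).2 ⟨hag, hfr⟩)]
      rw [← Finset.prod_subset (Finset.subset_univ (freeCols E σ))]
      · refine Finset.prod_congr rfl fun k hk => ?_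
        exact elim_one_eq_constMat E ((mem_freeCols E).1 (hfr k hk))
      · intro k _ hk
        obtain ⟨μ, hμ⟩ := exists_eq_some_of_not_mem_freeCols E hk
        rw [hag k hk]
        exact (elim_one_eq_one E hμ).1
    · rw [if_neg fun h => hfr ((monoOfO_eq_iff E hro).1 h).2]
      obtain ⟨k, hk, hkτ⟩ : ∃ k, k ∈ freeCols E σ ∧ k ∉ freeCols E τ := by
        simpa using hfr
      obtain ⟨μ, hμ⟩ := exists_eq_some_of_not_mem_freeCols E hkτ
      exact .symm <| Finset.prod_eq_zero (f := fun j => constMat E (τ j) j) hk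
        (elim_one_eq_one E hμ).2
  · rw [if_neg hag, if_neg fun h => hag ((monoOfO_eq_iff E hro).1 h).1]

/-- Leibniz term of the exchange matrix: non-zero only for `τ` agreeing with `σ` on the matched
columns, and then the product of the constant matrix over the free columns. [this file] -/
theorem prod_exchMat_eq (E : Matrix (Fin r) (Fin r) (M ⊕ F)) (σ τ : Equiv.Perm (Fin r)) :
    ∏ k, exchMat E σ (τ k) k =
      if (∀ k, k ∉ freeCols E σ → τ k = σ k) then
        ∏ k ∈ freeCols E σ, constMat E (τ k) k else 0 := by
  by_cases hag : ∀ k, k ∉ freeCols E σ → τ k = σ k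
  · rw [if_pos hag, ← Finset.prod_subset (Finset.subset_univ (freeCols E σ))]
    · exact Finset.prod_congr rfl fun k hk => by simp only [exchMat, if_pos hk]
    · intro k _ hk
      simp only [exchMat, if_neg hk, if_pos (hag k hk)]
  · rw [if_neg hag]
    obtain ⟨k, hk, hne⟩ : ∃ k, k ∉ freeCols E σ ∧ τ k ≠ σ k := by simpa using hag
    exact Finset.prod_eq_zero (Finset.mem_univ k)
      (by simp only [exchMat, if_neg hk, if_neg hne])

/-! ### §3 The coefficient of a matching monomial is the determinant of its exchange matrix -/

/-- **Coefficient = ONE determinant.**  For a read-once template, the coefficient in `D_E` of the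
monomial of `σ` is the determinant of its exchange matrix. [cite: FurueHirai2019, Lemma 3.1] -/
theorem coeff_monoOfO_eq_det_exchMat [DecidableEq M] (E : Matrix (Fin r) (Fin r) (M ⊕ F))
    (hro : ∀ p q : Fin r × Fin r, ∀ m, E p.1 p.2 = .inl m → E q.1 q.2 = .inl m → p = q)
    (σ : Equiv.Perm (Fin r)) :
    coeff (monoOfO (optLab E) σ) (E.map (Sum.elim MvPolynomial.X MvPolynomial.C)).det =
      (exchMat E σ).det := by
  rw [coeff_det_eq E, Finset.sum_filter, Matrix.det_apply']
  refine Finset.sum_congr rfl fun τ _ => ?_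
  rw [prod_exchMat_eq, ← ite_prodConst_eq E hro σ τ]
  split_ifs <;> simp

/-! ### §4 The exchange determinant is the signed complementary minor -/

/-- **Exchange determinant = signed complementary minor** (expand the unit columns).
[cite: FurueHirai2019, Lemma 3.1] -/
theorem det_exchMat_eq_sign_mul_det_coMinor (E : Matrix (Fin r) (Fin r) (M ⊕ F))
    (σ : Equiv.Perm (Fin r)) :
    (exchMat E σ).det = ((Equiv.Perm.sign σ : ℤ) : F) * (coMinor E σ).det := by
  classical
  set S := freeCols E σ with hS
  let P : Equiv.Perm (Fin r) → Prop := fun ρ => ∀ a, ¬ (a ∈ S) → ρ a = a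
  let g : Equiv.Perm (Fin r) → F := fun ρ =>
    ((Equiv.Perm.sign ρ : ℤ) : F) * ∏ k ∈ S, constMat E (σ (ρ k)) k
  have hstep : ∀ ρ : Equiv.Perm (Fin r),
      ((Equiv.Perm.sign (σ * ρ) : ℤ) : F) * ∏ k, exchMat E σ ((σ * ρ) k) k =
        ((Equiv.Perm.sign σ : ℤ) : F) * if P ρ then g ρ else 0 := by
    intro ρ; rw [prod_exchMat_eq]
    have hiff : (∀ k, k ∉ freeCols E σ → (σ * ρ) k = σ k) ↔ P ρ := by
      simp only [P, Equiv.Perm.mul_apply, σ.apply_eq_iff_eq, hS]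
    by_cases hP : P ρ
    · rw [if_pos (hiff.2 hP), if_pos hP, Equiv.Perm.sign_mul, Units.val_mul, Int.cast_mul]
      simp only [g, Equiv.Perm.mul_apply, hS]
      ring
    · rw [if_neg fun h => hP (hiff.1 h), if_neg hP, mul_zero, mul_zero]
  calc (exchMat E σ).det
      = ∑ τ, ((Equiv.Perm.sign τ : ℤ) : F) * ∏ k, exchMat E σ (τ k) k :=
        Matrix.det_apply' _
    _ = ∑ ρ, ((Equiv.Perm.sign (σ * ρ) : ℤ) : F) * ∏ k, exchMat E σ ((σ * ρ) k) k :=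
        (Equiv.sum_comp (Equiv.mulLeft σ) _).symm
    _ = ((Equiv.Perm.sign σ : ℤ) : F) * ∑ ρ, if P ρ then g ρ else 0 := by
        rw [Finset.mul_sum]; exact Finset.sum_congr rfl fun ρ _ => hstep ρ
    _ = ((Equiv.Perm.sign σ : ℤ) : F) * ∑ ρ ∈ Finset.univ.filter P, g ρ :=
        congrArg _ (Finset.sum_filter _ _).symm
    _ = ((Equiv.Perm.sign σ : ℤ) : F) * ∑ ρ : {ρ : Equiv.Perm (Fin r) // P ρ}, g ρ.1 :=
        congrArg _ (Finset.sum_subtype _ (fun ρ => by simp) _)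
    _ = ((Equiv.Perm.sign σ : ℤ) : F) * ∑ π : Equiv.Perm S, g (Equiv.Perm.ofSubtype π) :=
        congrArg _ (Equiv.sum_comp (Equiv.Perm.subtypeEquivSubtypePerm (· ∈ S)) _).symm
    _ = ((Equiv.Perm.sign σ : ℤ) : F) * (coMinor E σ).det := by
        rw [Matrix.det_apply']
        refine congrArg _ (Finset.sum_congr rfl fun π _ => ?_)
        simp only [g, Equiv.Perm.sign_ofSubtype, ← Finset.prod_coe_sort S, coMinor,
          Equiv.Perm.ofSubtype_apply_coe]
        rfl

/-- **Coefficient = signed complementary minor.** [cite: FurueHirai2019, Lemma 3.1] -/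
theorem coeff_monoOfO_eq_sign_mul_det_coMinor [DecidableEq M]
    (E : Matrix (Fin r) (Fin r) (M ⊕ F))
    (hro : ∀ p q : Fin r × Fin r, ∀ m, E p.1 p.2 = .inl m → E q.1 q.2 = .inl m → p = q)
    (σ : Equiv.Perm (Fin r)) :
    coeff (monoOfO (optLab E) σ) (E.map (Sum.elim MvPolynomial.X MvPolynomial.C)).det =
      ((Equiv.Perm.sign σ : ℤ) : F) * (coMinor E σ).det := by
  rw [coeff_monoOfO_eq_det_exchMat E hro, det_exchMat_eq_sign_mul_det_coMinor]

/-! ### §5 Support, non-vanishing and isolation over the matching–minor family -/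

/-- **Support = matching–minor family**: the monomials of the permutations with non-singular
exchange matrix (equivalently: non-zero complementary minor). [this file] -/
theorem mem_support_iff_exists_exchMat [DecidableEq M] (E : Matrix (Fin r) (Fin r) (M ⊕ F))
    (hro : ∀ p q : Fin r × Fin r, ∀ m, E p.1 p.2 = .inl m → E q.1 q.2 = .inl m → p = q)
    {m : M →₀ ℕ} :
    m ∈ (E.map (Sum.elim MvPolynomial.X MvPolynomial.C)).det.support ↔
      ∃ σ : Equiv.Perm (Fin r), monoOfO (optLab E) σ = m ∧ (exchMat E σ).det ≠ 0 := by
  refine ⟨fun hm => ?_, fun ⟨σ, hσm, hσ⟩ => ?_⟩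
  · obtain ⟨σ, -, hσ⟩ := exists_perm_of_mem_support E hm
    refine ⟨σ, hσ, ?_⟩
    rw [← coeff_monoOfO_eq_det_exchMat E hro σ, hσ]
    exact MvPolynomial.mem_support_iff.1 hm
  · rw [MvPolynomial.mem_support_iff, ← hσm, coeff_monoOfO_eq_det_exchMat E hro σ]
    exact hσ

/-- **Non-vanishing = one non-singular exchange.** [this file] -/
theorem det_ne_zero_iff_exists_exchMat [DecidableEq M] (E : Matrix (Fin r) (Fin r) (M ⊕ F))
    (hro : ∀ p q : Fin r × Fin r, ∀ m, E p.1 p.2 = .inl m → E q.1 q.2 = .inl m → p = q) :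
    (E.map (Sum.elim MvPolynomial.X MvPolynomial.C)).det ≠ 0 ↔
      ∃ σ : Equiv.Perm (Fin r), (exchMat E σ).det ≠ 0 := by
  rw [MvPolynomial.ne_zero_iff]
  exact ⟨fun ⟨m, hm⟩ => ((mem_support_iff_exists_exchMat E hro).1
      (MvPolynomial.mem_support_iff.2 hm)).imp fun _ h => h.2, fun ⟨σ, hσ⟩ => ⟨_,
    mem_support_iff.1 ((mem_support_iff_exists_exchMat E hro).2 ⟨σ, rfl, hσ⟩)⟩⟩

/-- **Isolation over the matching–minor family** (the TARGET of rung 2, typed): a weight on the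
variables isolates a unique minimum-weight monomial of `D_E` iff it isolates a minimum-weight
NON-SINGULAR EXCHANGE (a common base) up to equal monomials. [cite: GurjarThierauf2017, Abstract] -/
theorem isolatesMin_iff_exchMat [DecidableEq M] (E : Matrix (Fin r) (Fin r) (M ⊕ F))
    (hro : ∀ p q : Fin r × Fin r, ∀ m, E p.1 p.2 = .inl m → E q.1 q.2 = .inl m → p = q)
    (w : M → ℕ) :
    SuccinctTables.IsolatesMin F w (E.map (Sum.elim MvPolynomial.X MvPolynomial.C)).det ↔
      ∃ σ : Equiv.Perm (Fin r), (exchMat E σ).det ≠ 0 ∧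
        ∀ τ : Equiv.Perm (Fin r), (exchMat E τ).det ≠ 0 →
          monoOfO (optLab E) τ ≠ monoOfO (optLab E) σ →
            ∑ k, (optLab E k (σ k)).elim 0 w < ∑ k, (optLab E k (τ k)).elim 0 w := by
  unfold SuccinctTables.IsolatesMin
  constructor
  · rintro ⟨m₀, hm₀, hmin⟩
    obtain ⟨σ, rfl, hσ⟩ := (mem_support_iff_exists_exchMat E hro).1 hm₀
    refine ⟨σ, hσ, fun τ hτ hne => ?_⟩
    have h := hmin _ ((mem_support_iff_exists_exchMat E hro).2 ⟨τ, rfl, hτ⟩) hne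
    rwa [sum_monoOfO, sum_monoOfO] at h
  · rintro ⟨σ, hσ, hmin⟩
    refine ⟨_, (mem_support_iff_exists_exchMat E hro).2 ⟨σ, rfl, hσ⟩, fun m hm hne => ?_⟩
    obtain ⟨τ, rfl, hτ⟩ := (mem_support_iff_exists_exchMat E hro).1 hm
    rw [sum_monoOfO, sum_monoOfO]
    exact hmin τ hτ hne

end

end Summit.ValiantsHypothesis.ValiantsHypothesis.Theorems.ReadOnceComplementaryMinor
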